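import Literature.Analysis.FluidPDE.EulerSymmetricGradient
import Literature.Analysis.FluidPDE.MollifiedSolenoidalTest
import HarnessLib

/-!
# Fields with bounded symmetric gradient: flux against mollified solenoidal fields, and
the vanishing of `⟨(∇v + ∇vᵀ) v, v⟩`

Analysis/FluidPDE support file (serves the discharge of the barrier fact
`Literature.Barriers.AnomalousDissipation.BrenierDeLellisSzekelyhidi2011_cor1`, Brenier–De Lellis–
Székelyhidi 2011, Cor. 1, time-slice level). Let `v ∈ L²(E;E)` be weakly divergence free with a
weak gradient `G` whose symmetric part `S = G + Gᵀ` is essentially bounded.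

* `integral_inner_fderiv_normed_convolution_apply_self_eq`: the flux identity of
  `EulerSymmetricGradient` (`∫ ⟪v, (v·∇)Φ⟫ = -∫ ⟪S v, Φ⟫` for `Φ ∈ 𝒱`) extends to the mollified
  solenoidal fields `Φ = φ ⋆ w`, `w ∈ L²` weakly divergence free (density of `𝒱`,
  `MollifiedSolenoidalTest`).
* `integral_inner_symGrad_apply_self_eq_zero`: `∫ ⟪S v, v⟫ = 0` — the weak form of
  `∫ ⟪(v·∇)v, v⟫ = 0`, i.e. conservation of the kinetic energy of the Euler solution of
  Brenier–De Lellis–Székelyhidi, Thm. 2 (there obtained from the local energy identity and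
  `p ∈ L²`; here: test the extended flux identity with `Φ = φₙ ⋆ v` itself, whose left side is
  `½ ∫ ⟪(φₙ ⋆ S) v, v⟫ → ½ ∫ ⟪S v, v⟫` while the right side tends to `-∫ ⟪S v, v⟫`).
* `memLp_symGrad_apply`: `S v ∈ L²` with `‖S v‖₂ ≤ C ‖v‖₂`.

## Mathlib / tree search

Builds only on the two preceding support files (`EulerSymmetricGradient`,
`MollifiedSolenoidalTest`) and the mollification toolkit; nothing comparable in Mathlib or the
tree (searched `symGrad`, `adjoint (G`).

## References

* Y. Brenier, C. De Lellis, L. Székelyhidi Jr., *Weak-strong uniqueness for measure-valued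
  solutions*, Comm. Math. Phys. 305 (2011), §3.1, Thm. 2 with (8), proof p. 6 of
  arXiv:0912.1028 ("`∫ |v|²(x,t) dx` is constant"). [BrenierDeLellisSzekelyhidi2011]
-/

noncomputable section

open MeasureTheory TopologicalSpace Set Function Filter ContinuousLinearMap
open scoped ENNReal NNReal Convolution InnerProductSpace RealInnerProductSpace Topology

namespace Literature.Analysis.FluidPDE

variable {E : Type*} [NormedAddCommGroup E] [InnerProductSpace ℝ E] [FiniteDimensional ℝ E]
  [MeasurableSpace E] [BorelSpace E] [CompleteSpace E]

section Slice

variable {v : E → E} {G : E → E →L[ℝ] E}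

omit [CompleteSpace E] in
/-- **`S v ∈ L²`** for `v ∈ L²` and an essentially bounded measurable operator field `S`,
with `‖S v‖_{L²} ≤ C ‖v‖_{L²}`. [folklore] -/
theorem memLp_clm_apply_of_ae_norm_le {S : E → E →L[ℝ] E} (hS : AEStronglyMeasurable S volume)
    (hv2 : MemLp v 2 volume) {C : ℝ≥0} (hC : ∀ᵐ x ∂(volume : Measure E), ‖S x‖ ≤ C) :
    MemLp (fun x => S x (v x)) 2 volume ∧
      eLpNorm (fun x => S x (v x)) 2 volume ≤ C * eLpNorm v 2 volume := by
  have hle : eLpNorm (fun x => S x (v x)) 2 volume ≤ C * eLpNorm v 2 volume := by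
    have h := eLpNorm_clm_apply_le (b := v) hC 2
    rwa [ENNReal.smul_def, smul_eq_mul] at h
  exact ⟨⟨aestronglyMeasurable_clm_apply hS hv2.1,
    hle.trans_lt (ENNReal.mul_lt_top ENNReal.coe_lt_top hv2.eLpNorm_lt_top)⟩, hle⟩

omit [CompleteSpace E] in
/-- The symmetric-gradient field `x ↦ G x + (G x)ᵀ` of a weak-gradient witness is a.e.-strongly
measurable. [folklore] -/
theorem HasWeakGradient.aestronglyMeasurable_symGrad [CompleteSpace E] (hG : HasWeakGradient v G) :
    AEStronglyMeasurable (fun x => G x + adjoint (G x)) volume :=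
  (LocallyIntegrable.add (ε'' := E →L[ℝ] E) hG.locallyIntegrable_grad
    (locallyIntegrable_adjoint hG.locallyIntegrable_grad)).aestronglyMeasurable

/-- **The flux identity against mollified solenoidal fields.** Let `v ∈ L²` be weakly
divergence free with weak gradient `G`, `‖G + Gᵀ‖ ≤ C` a.e., let `w ∈ L²` be weakly divergence
free and `φ` a bump kernel. Then
`∫ ⟪v, D(φ ⋆ w) v⟫ = -∫ ⟪(G + Gᵀ) v, φ ⋆ w⟫`
(the accepted identity for `𝒱`, `integral_inner_fderiv_apply_self_eq_neg_integral_inner_symGrad`,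
extended along `φ ⋆ ψⱼ → φ ⋆ w`, `ψⱼ ∈ 𝒱`, `ψⱼ → w` in `L²`). [cite: BrenierDeLellisSzekelyhidi2011, §3.1 Thm. 2 with (8)] -/
theorem integral_inner_fderiv_normed_convolution_apply_self_eq (hv2 : MemLp v 2 volume)
    (hdiv : IsWeaklyDivFree v) (hG : HasWeakGradient v G) {C : ℝ}
    (hC : ∀ᵐ x ∂(volume : Measure E), ‖G x + adjoint (G x)‖ ≤ C) (φ : ContDiffBump (0 : E))
    {w : E → E} (hw : MemLp w 2 volume) (hwdiv : IsWeaklyDivFree w) :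
    ∫ x, ⟪v x, fderiv ℝ (φ.normed volume ⋆[lsmul ℝ ℝ, volume] w) x (v x)⟫ =
      -∫ x, ⟪(G x + adjoint (G x)) (v x), (φ.normed volume ⋆[lsmul ℝ ℝ, volume] w) x⟫ := by
  set ρ : E → ℝ := φ.normed volume with hρ
  set S : E → E →L[ℝ] E := fun x => G x + adjoint (G x) with hS
  have hC0 : 0 ≤ C := by
    obtain ⟨x, hx⟩ := hC.exists
    exact (norm_nonneg _).trans hx
  set Cn : ℝ≥0 := ⟨C, hC0⟩ with hCn
  have hSm : AEStronglyMeasurable S volume := hG.aestronglyMeasurable_symGrad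
  obtain ⟨hSv2, -⟩ := memLp_clm_apply_of_ae_norm_le hSm hv2 (C := Cn) hC
  have hwl : LocallyIntegrable w volume := hw.locallyIntegrable one_le_two
  obtain ⟨ψ, hψ, hψlim⟩ := exists_divFreeTest_tendsto_eLpNorm hw hwdiv
  have hψ2 : ∀ j, MemLp (ψ j) 2 volume := fun j => memLp_of_mem_divFreeTest (hψ j) 2
  have hψl : ∀ j, LocallyIntegrable (ψ j) volume := fun j => (hψ2 j).locallyIntegrable one_le_two
  have hd2 : ∀ j, MemLp (ψ j - w) 2 volume := fun j => (hψ2 j).sub hw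
  set Ψ : E → E := ρ ⋆[lsmul ℝ ℝ, volume] w with hΨ
  set Ψj : ℕ → E → E := fun j => ρ ⋆[lsmul ℝ ℝ, volume] ψ j with hΨj
  set Dj : ℕ → E → E := fun j => ρ ⋆[lsmul ℝ ℝ, volume] (ψ j - w) with hDj
  have hΨjV : ∀ j, Ψj j ∈ divFreeTest E := fun j => normed_convolution_mem_divFreeTest φ (hψ j)
  have hDj_eq : ∀ j, Ψj j - Ψ = Dj j := fun j => (normed_convolution_sub φ (hψl j) hwl).symm
  -- the identity for `Ψⱼ ∈ 𝒱`
  have hid : ∀ j, ∫ x, ⟪v x, fderiv ℝ (Ψj j) x (v x)⟫ = -∫ x, ⟪S x (v x), Ψj j x⟫ := fun j =>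
    integral_inner_fderiv_apply_self_eq_neg_integral_inner_symGrad hv2 hdiv hG hC (hΨjV j).1
      (hΨjV j).2
  -- `L²` data
  have hΨ2 : MemLp Ψ 2 volume := FunctionSpaces.memLp_normed_convolution φ hw one_le_two
  have hΨj2 : ∀ j, MemLp (Ψj j) 2 volume := fun j =>
    FunctionSpaces.memLp_normed_convolution φ (hψ2 j) one_le_two
  have hΨjlim : Tendsto (fun j => eLpNorm (Ψj j - Ψ) 2 volume) atTop (𝓝 0) := by
    refine tendsto_of_tendsto_of_tendsto_of_le_of_le tendsto_const_nhds hψlim (fun _ => zero_le)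
      fun j => ?_
    rw [hDj_eq j]
    exact FunctionSpaces.eLpNorm_normed_convolution_le φ (hd2 j).1 one_le_two
  -- ### right-hand side
  have hR : Tendsto (fun j => -∫ x, ⟪S x (v x), Ψj j x⟫) atTop (𝓝 (-∫ x, ⟪S x (v x), Ψ x⟫)) :=
    (tendsto_integral_inner_right_of_tendsto_eLpNorm hSv2 (Eventually.of_forall hΨj2) hΨ2
      hΨjlim).neg
  -- ### left-hand side
  have hΨs : ContDiff ℝ 1 Ψ := contDiff_normed_convolution_of_locallyIntegrable φ hwl
  have hΨjs : ∀ j, ContDiff ℝ 1 (Ψj j) := fun j =>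
    contDiff_normed_convolution_of_locallyIntegrable φ (hψl j)
  have hDjs : ∀ j, ContDiff ℝ 1 (Dj j) := fun j =>
    contDiff_normed_convolution_of_locallyIntegrable φ ((hd2 j).locallyIntegrable one_le_two)
  set K₁ : ℝ := (eLpNorm (fderiv ℝ ρ) 2 volume).toReal with hK₁
  have hK₁0 : 0 ≤ K₁ := ENNReal.toReal_nonneg
  set d : ℕ → ℝ := fun j => (eLpNorm (ψ j - w) 2 volume).toReal with hd
  have hd0 : ∀ j, 0 ≤ d j := fun j => ENNReal.toReal_nonneg
  have hdlim : Tendsto d atTop (𝓝 0) := by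
    rw [← ENNReal.toReal_zero]
    exact (ENNReal.tendsto_toReal ENNReal.zero_ne_top).comp hψlim
  have hDsub : ∀ j x, fderiv ℝ (Ψj j) x - fderiv ℝ Ψ x = fderiv ℝ (Dj j) x := by
    intro j x
    have h1 : Ψj j = Dj j + Ψ := by rw [← hDj_eq j, sub_add_cancel]
    rw [h1, fderiv_add ((hDjs j).differentiable one_ne_zero x) (hΨs.differentiable one_ne_zero x)]
    simp
  have hL : Tendsto (fun j => ∫ x, ⟪v x, fderiv ℝ (Ψj j) x (v x)⟫) atTop
      (𝓝 (∫ x, ⟪v x, fderiv ℝ Ψ x (v x)⟫)) := by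
    set N : ℝ := (eLpNorm v 2 volume).toReal with hN
    have hbound : ∀ j, |(∫ x, ⟪v x, fderiv ℝ (Ψj j) x (v x)⟫) - ∫ x, ⟪v x, fderiv ℝ Ψ x (v x)⟫| ≤
        K₁ * d j * N * N := by
      intro j
      obtain ⟨i1, -⟩ := abs_integral_inner_clm_apply_le_of_norm_le hv2 hv2
        ((hΨjs j).continuous_fderiv one_ne_zero).aestronglyMeasurable (by positivity)
        (fun x => norm_fderiv_normed_convolution_le φ (hψ2 j) x)
      obtain ⟨i2, -⟩ := abs_integral_inner_clm_apply_le_of_norm_le hv2 hv2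
        (hΨs.continuous_fderiv one_ne_zero).aestronglyMeasurable (by positivity)
        (fun x => norm_fderiv_normed_convolution_le φ hw x)
      obtain ⟨-, b3⟩ := abs_integral_inner_clm_apply_le_of_norm_le hv2 hv2
        ((hDjs j).continuous_fderiv one_ne_zero).aestronglyMeasurable (mul_nonneg hK₁0 (hd0 j))
        (fun x => norm_fderiv_normed_convolution_le φ (hd2 j) x)
      rw [← integral_sub i1 i2]
      have heq : (fun x => ⟪v x, fderiv ℝ (Ψj j) x (v x)⟫ - ⟪v x, fderiv ℝ Ψ x (v x)⟫) =
          fun x => ⟪v x, fderiv ℝ (Dj j) x (v x)⟫ := by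
        ext x
        rw [← inner_sub_right, ← sub_apply, hDsub j x]
      rw [heq]
      exact b3
    rw [Metric.tendsto_atTop]
    intro ε hε
    have hδ : Tendsto (fun j => K₁ * d j * N * N) atTop (𝓝 0) := by
      simpa using ((hdlim.const_mul K₁).mul_const N).mul_const N
    obtain ⟨M, hM⟩ := Metric.tendsto_atTop.1 hδ ε hε
    refine ⟨M, fun j hj => ?_⟩
    have h1 := hM j hj
    rw [Real.dist_eq, sub_zero] at h1
    rw [Real.dist_eq]
    exact (hbound j).trans_lt (lt_of_abs_lt h1)
  -- ### conclusion
  have h := hL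
  simp_rw [hid] at h
  exact tendsto_nhds_unique h hR

/-- **`∫ ⟪(G + Gᵀ) v, v⟫ = 0`** for `v ∈ L²` weakly divergence free with weak gradient `G` and
`‖G + Gᵀ‖ ≤ C` a.e.: the weak form of `∫ ⟪(v·∇)v, v⟫ = 0`, which gives the conservation of the
kinetic energy `∫ |v|²` of the Euler solution in Brenier–De Lellis–Székelyhidi 2011, proof of
Thm. 2 ("`∫ |v|²(x,t) dx` is constant", p. 6). Proof: the flux identity with `Φ = φₙ ⋆ v` reads
`½ ∫ ⟪(φₙ ⋆ S) v, v⟫ = -∫ ⟪S v, φₙ ⋆ v⟫` (`D(φₙ ⋆ v) + D(φₙ ⋆ v)ᵀ = φₙ ⋆ S`), and letting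
`n → ∞` (dominated convergence on the left, `φₙ ⋆ v → v` in `L²` on the right) gives
`½ X = -X` for `X = ∫ ⟪S v, v⟫`. [cite: BrenierDeLellisSzekelyhidi2011, §3.1 proof of Thm. 2] -/
theorem integral_inner_symGrad_apply_self_eq_zero (hv2 : MemLp v 2 volume)
    (hdiv : IsWeaklyDivFree v) (hG : HasWeakGradient v G) {C : ℝ}
    (hC : ∀ᵐ x ∂(volume : Measure E), ‖G x + adjoint (G x)‖ ≤ C) :
    ∫ x, ⟪(G x + adjoint (G x)) (v x), v x⟫ = 0 := by
  obtain ⟨φ, hφ, h'φ⟩ := FunctionSpaces.exists_contDiffBump_seq (E := E)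
  set S : E → E →L[ℝ] E := fun x => G x + adjoint (G x) with hS
  set X : ℝ := ∫ x, ⟪S x (v x), v x⟫ with hX
  have hC0 : 0 ≤ C := by
    obtain ⟨x, hx⟩ := hC.exists
    exact (norm_nonneg _).trans hx
  set Cn : ℝ≥0 := ⟨C, hC0⟩ with hCn
  have hSm : AEStronglyMeasurable S volume := hG.aestronglyMeasurable_symGrad
  obtain ⟨hSv2, -⟩ := memLp_clm_apply_of_ae_norm_le hSm hv2 (C := Cn) hC
  have hvl : LocallyIntegrable v volume := hG.locallyIntegrable_self
  set vn : ℕ → E → E := fun n => (φ n).normed volume ⋆[lsmul ℝ ℝ, volume] v with hvn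
  have hvn2 : ∀ n, MemLp (vn n) 2 volume := fun n =>
    FunctionSpaces.memLp_normed_convolution (φ n) hv2 one_le_two
  have hvnlim : Tendsto (fun n => eLpNorm (vn n - v) 2 volume) atTop (𝓝 0) :=
    FunctionSpaces.tendsto_eLpNorm_normed_convolution_sub_self (μ := (volume : Measure E)) hφ
      one_le_two ENNReal.ofNat_ne_top hv2
  -- the mollified symmetric gradients
  set Sn : ℕ → E → E →L[ℝ] E := fun n x =>
    fderiv ℝ (vn n) x + adjoint (fderiv ℝ (vn n) x) with hSn
  have hSl : LocallyIntegrable S volume :=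
    LocallyIntegrable.add (ε'' := E →L[ℝ] E) hG.locallyIntegrable_grad
      (locallyIntegrable_adjoint hG.locallyIntegrable_grad)
  have hSn_eq : ∀ n x, Sn n x = ((φ n).normed volume ⋆[lsmul ℝ ℝ, volume] S) x := fun n x =>
    hG.symGrad_normed_convolution (φ n) x
  have hSn_le : ∀ n x, ‖Sn n x‖ ≤ C := fun n x => hG.norm_symGrad_normed_convolution_le (φ n) hC x
  have hSn_c : ∀ n, Continuous (Sn n) := fun n => by
    have hs : ContDiff ℝ 1 (vn n) := hG.contDiff_convolution (FunctionSpaces.isTestFunctionOn_normed (φ n))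
    have hD : Continuous (fderiv ℝ (vn n)) := hs.continuous_fderiv one_ne_zero
    exact hD.add ((adjoint : (E →L[ℝ] E) ≃ₗᵢ⋆[ℝ] (E →L[ℝ] E)).continuous.comp hD)
  have hSn_ae : ∀ᵐ x ∂(volume : Measure E), Tendsto (fun n => Sn n x) atTop (𝓝 (S x)) := by
    filter_upwards [FunctionSpaces.ae_tendsto_normed_convolution hφ h'φ hSl] with x hx
    simpa only [hSn_eq] using hx
  -- (1) the flux identity with `Φ = φₙ ⋆ v`
  have h1 : ∀ n, ∫ x, ⟪v x, fderiv ℝ (vn n) x (v x)⟫ = -∫ x, ⟪S x (v x), vn n x⟫ := fun n =>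
    integral_inner_fderiv_normed_convolution_apply_self_eq hv2 hdiv hG hC (φ n) hv2 hdiv
  -- (2) its left side is `½ ∫ ⟪Sₙ v, v⟫`
  have h2 : ∀ n, ∫ x, ⟪v x, fderiv ℝ (vn n) x (v x)⟫ = 2⁻¹ * ∫ x, ⟪Sn n x (v x), v x⟫ := by
    intro n
    rw [← integral_const_mul]
    refine integral_congr_ae (ae_of_all _ fun x => ?_)
    dsimp only
    rw [real_inner_comm, inner_apply_self_eq_half_inner_symGrad]
  -- (3) `∫ ⟪Sₙ v, v⟫ → X` by dominated convergence
  have h3 : Tendsto (fun n => ∫ x, ⟪Sn n x (v x), v x⟫) atTop (𝓝 X) := by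
    have hv2i : Integrable (fun x => ‖v x‖ ^ 2) volume :=
      (memLp_two_iff_integrable_sq_norm hv2.1).1 hv2
    refine tendsto_integral_of_dominated_convergence (fun x => C * ‖v x‖ ^ 2)
      (fun n => ?_) (hv2i.const_mul C) (fun n => ae_of_all _ fun x => ?_) ?_
    · exact (aestronglyMeasurable_clm_apply (hSn_c n).aestronglyMeasurable hv2.1).inner hv2.1
    · rw [Real.norm_eq_abs]
      calc |⟪Sn n x (v x), v x⟫| ≤ ‖Sn n x (v x)‖ * ‖v x‖ := abs_real_inner_le_norm _ _
        _ ≤ C * ‖v x‖ * ‖v x‖ := by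
            gcongr
            exact (le_opNorm _ _).trans (mul_le_mul_of_nonneg_right (hSn_le n x) (norm_nonneg _))
        _ = C * ‖v x‖ ^ 2 := by ring
    · filter_upwards [hSn_ae] with x hx
      have hx' : Tendsto (fun n => Sn n x (v x)) atTop (𝓝 (S x (v x))) :=
        ((ContinuousLinearMap.apply ℝ E (v x)).continuous.tendsto _).comp hx
      exact hx'.inner tendsto_const_nhds
  -- (4) the right side tends to `-X`
  have h4 : Tendsto (fun n => -∫ x, ⟪S x (v x), vn n x⟫) atTop (𝓝 (-X)) :=
    (tendsto_integral_inner_right_of_tendsto_eLpNorm hSv2 (Eventually.of_forall hvn2) hv2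
      hvnlim).neg
  -- conclusion: `½ X = -X`
  have h5 : Tendsto (fun n => ∫ x, ⟪v x, fderiv ℝ (vn n) x (v x)⟫) atTop (𝓝 (2⁻¹ * X)) := by
    simp_rw [h2]; exact h3.const_mul _
  have h6 : Tendsto (fun n => ∫ x, ⟪v x, fderiv ℝ (vn n) x (v x)⟫) atTop (𝓝 (-X)) := by
    simp_rw [h1]; exact h4
  have h7 := tendsto_nhds_unique h5 h6
  linarith

end Slice

/-! ### Time mollification of an `L¹ₜL²ₓ – L^∞ₜL²ₓ` pairing -/

section TimeMollification

variable {X : Type*} [MeasurableSpace X] {μ : Measure X} [SFinite μ]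
variable {V : Type*} [NormedAddCommGroup V] [InnerProductSpace ℝ V] [CompleteSpace V]

omit [NormedAddCommGroup E] [InnerProductSpace ℝ E] [FiniteDimensional ℝ E] [MeasurableSpace E]
  [BorelSpace E] [CompleteSpace E] in
/-- **Uniform approximation and limits** (real sequences): if `x⁽ᴹ⁾ₙ → y⁽ᴹ⁾` for every `M` and
`|xₙ - x⁽ᴹ⁾ₙ|, |y - y⁽ᴹ⁾| ≤ e_M` with `e_M → 0`, then `xₙ → y`. [folklore] -/
theorem tendsto_of_approx_of_tendsto {x : ℕ → ℝ} {y : ℝ} {xM : ℕ → ℕ → ℝ} {yM : ℕ → ℝ}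
    {e : ℕ → ℝ} (h1 : ∀ M, Tendsto (xM M) atTop (𝓝 (yM M)))
    (hx : ∀ M n, |x n - xM M n| ≤ e M) (hy : ∀ M, |y - yM M| ≤ e M)
    (he : Tendsto e atTop (𝓝 0)) : Tendsto x atTop (𝓝 y) := by
  rw [Metric.tendsto_atTop]
  intro ε hε
  obtain ⟨M, hM⟩ := Metric.tendsto_atTop.1 he (ε / 4) (by positivity)
  have heM : e M < ε / 4 := by
    have := hM M le_rfl
    rw [Real.dist_eq, sub_zero] at this
    exact lt_of_abs_lt this
  obtain ⟨N, hN⟩ := Metric.tendsto_atTop.1 (h1 M) (ε / 4) (by positivity)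
  refine ⟨N, fun n hn => ?_⟩
  have h := hN n hn
  rw [Real.dist_eq] at h ⊢
  calc |x n - y| = |(x n - xM M n) + (xM M n - yM M) + (yM M - y)| := by ring_nf
    _ ≤ |x n - xM M n| + |xM M n - yM M| + |yM M - y| := abs_add_three _ _ _
    _ < ε / 4 + ε / 4 + ε / 4 := by
        have h3 : |yM M - y| ≤ e M := by rw [abs_sub_comm]; exact hy M
        linarith [hx M n, h3]
    _ < ε := by linarith

omit [NormedAddCommGroup E] [InnerProductSpace ℝ E] [FiniteDimensional ℝ E] [MeasurableSpace E]
  [BorelSpace E] [CompleteSpace E] [CompleteSpace V] in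
/-- The slice pairing `(σ, s) ↦ ∫ ⟪Φ(s), A(σ)⟫` of two jointly measurable fields is jointly
measurable. [folklore] -/
theorem stronglyMeasurable_integral_inner_slice {A Φ : ℝ → X → V}
    (hA : StronglyMeasurable (uncurry A)) (hΦ : StronglyMeasurable (uncurry Φ)) :
    StronglyMeasurable fun p : ℝ × ℝ => ∫ x, ⟪Φ p.2 x, A p.1 x⟫ ∂μ := by
  have h : StronglyMeasurable fun q : (ℝ × ℝ) × X => ⟪Φ q.1.2 q.2, A q.1.1 q.2⟫ :=
    (hΦ.comp_measurable (measurable_fst.snd.prodMk measurable_snd)).inner (𝕜 := ℝ)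
      (hA.comp_measurable (measurable_fst.fst.prodMk measurable_snd))
  exact h.integral_prod_right'

omit [NormedAddCommGroup E] [InnerProductSpace ℝ E] [FiniteDimensional ℝ E] [MeasurableSpace E]
  [BorelSpace E] [CompleteSpace E] [CompleteSpace V] in
omit [SFinite μ] in
/-- Slice Cauchy–Schwarz with an `L²` bound on one factor: `‖∫ ⟪Φ(s), D(σ)⟫‖ ≤ R ‖D(σ)‖_{L²}`
if `‖Φ(s)‖_{L²} ≤ R` and `‖D(σ)‖_{L²} < ∞`. [folklore] -/
theorem norm_integral_inner_le_of_eLpNorm_le {Φs Dσ : X → V} (hΦ : AEStronglyMeasurable Φs μ)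
    (hD : AEStronglyMeasurable Dσ μ) {R : ℝ≥0} (hR : eLpNorm Φs 2 μ ≤ R)
    (hfin : eLpNorm Dσ 2 μ < ⊤) :
    ‖∫ x, ⟪Φs x, Dσ x⟫ ∂μ‖ ≤ R * (eLpNorm Dσ 2 μ).toReal := by
  have h := FunctionSpaces.enorm_integral_inner_le_eLpNorm_mul hΦ hD
  have h2 : ‖∫ x, ⟪Φs x, Dσ x⟫ ∂μ‖ₑ ≤ R * eLpNorm Dσ 2 μ := h.trans (mul_le_mul_left hR _)
  rw [← toReal_enorm, ← ENNReal.coe_toReal R, ← ENNReal.toReal_mul]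
  exact ENNReal.toReal_mono (ENNReal.mul_ne_top ENNReal.coe_ne_top hfin.ne) h2

omit [NormedAddCommGroup E] [InnerProductSpace ℝ E] [FiniteDimensional ℝ E] [MeasurableSpace E]
  [BorelSpace E] [CompleteSpace E] [CompleteSpace V] in
/-- **`L¹ₜL²ₓ – L^∞ₜL²ₓ` pairing on the slab.** If `‖Φ(s)‖_{L²} ≤ R` for all `s` and `D` has
integrable slice norms on `(0,t)`, then `(s,x) ↦ ⟪Φ(s,x), D(s,x)⟫` is integrable on `(0,t) × X` and
`|∫∫ ⟪Φ, D⟫| ≤ R ∫_{(0,t)} ‖D(s)‖_{L²} ds`. [folklore] -/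
theorem integrable_inner_slab_of_eLpNorm_le {t : ℝ} {D Φ : ℝ → X → V}
    (hD : StronglyMeasurable (uncurry D)) (hΦ : StronglyMeasurable (uncurry Φ))
    (hD1 : ∫⁻ s in Ioo 0 t, eLpNorm (D s) 2 μ < ∞) {R : ℝ≥0} (hΦR : ∀ s, eLpNorm (Φ s) 2 μ ≤ R) :
    Integrable (fun z : ℝ × X => ⟪Φ z.1 z.2, D z.1 z.2⟫)
        ((volume.restrict (Ioo 0 t)).prod μ) ∧
      |∫ z, ⟪Φ z.1 z.2, D z.1 z.2⟫ ∂((volume.restrict (Ioo 0 t)).prod μ)| ≤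
        R * (∫⁻ s in Ioo 0 t, eLpNorm (D s) 2 μ).toReal := by
  set νt : Measure ℝ := volume.restrict (Ioo 0 t) with hνt
  set N : ℝ → ℝ≥0∞ := fun s => eLpNorm (D s) 2 μ with hN
  have hNm : Measurable N := FunctionSpaces.measurable_eLpNorm_slice hD 2
  have hNfin : ∀ᵐ s ∂νt, N s < ⊤ := ae_lt_top hNm hD1.ne
  have hm : AEStronglyMeasurable (fun z : ℝ × X => ⟪Φ z.1 z.2, D z.1 z.2⟫) (νt.prod μ) :=
    (hΦ.inner (𝕜 := ℝ) hD).aestronglyMeasurable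
  -- integrability through the lower integral
  have hlin : ∫⁻ z, ‖⟪Φ z.1 z.2, D z.1 z.2⟫‖ₑ ∂(νt.prod μ) ≤ R * ∫⁻ s, N s ∂νt := by
    rw [lintegral_prod _ hm.enorm]
    calc ∫⁻ s, ∫⁻ x, ‖⟪Φ s x, D s x⟫‖ₑ ∂μ ∂νt ≤ ∫⁻ s, R * N s ∂νt := by
          refine lintegral_mono fun s => ?_
          exact (FunctionSpaces.lintegral_enorm_inner_le_eLpNorm_mul
            (hΦ.of_uncurry_left (x := s)).aestronglyMeasurable
            (hD.of_uncurry_left (x := s)).aestronglyMeasurable).trans (mul_le_mul_left (hΦR s) _)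
      _ = R * ∫⁻ s, N s ∂νt := lintegral_const_mul _ hNm
  have hint : Integrable (fun z : ℝ × X => ⟪Φ z.1 z.2, D z.1 z.2⟫) (νt.prod μ) :=
    ⟨hm, hlin.trans_lt (ENNReal.mul_lt_top ENNReal.coe_lt_top hD1)⟩
  refine ⟨hint, ?_⟩
  -- the bound through the iterated integral
  rw [integral_prod _ hint, ← Real.norm_eq_abs]
  have hslice : ∀ᵐ s ∂νt, ‖∫ x, ⟪Φ s x, D s x⟫ ∂μ‖ ≤ R * (N s).toReal := by
    filter_upwards [hNfin] with s hs
    exact norm_integral_inner_le_of_eLpNorm_le (hΦ.of_uncurry_left (x := s)).aestronglyMeasurable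
      (hD.of_uncurry_left (x := s)).aestronglyMeasurable (hΦR s) hs
  have hNint : Integrable (fun s => (N s).toReal) νt :=
    integrable_toReal_of_lintegral_ne_top hNm.aemeasurable hD1.ne
  calc ‖∫ s, ∫ x, ⟪Φ s x, D s x⟫ ∂μ ∂νt‖ ≤ ∫ s, R * (N s).toReal ∂νt :=
        norm_integral_le_of_norm_le (hNint.const_mul _) hslice
    _ = R * (∫⁻ s, N s ∂νt).toReal := by
        rw [integral_const_mul, integral_toReal hNm.aemeasurable hNfin]

omit [NormedAddCommGroup E] [InnerProductSpace ℝ E] [FiniteDimensional ℝ E] [MeasurableSpace E]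
  [BorelSpace E] [CompleteSpace E] [CompleteSpace V] in
/-- **Kernel-weighted `L¹ₜL²ₓ – L^∞ₜL²ₓ` bound on the time square.** If `‖Φ(s)‖_{L²} ≤ R` for
all `s` and `D` has integrable slice norms on `(0,t)`, then for a normalised bump kernel `ρ` the
weighted pairing `(σ,s) ↦ ρ(s-σ) ⟨Φ(s), D(σ)⟩` is integrable on `(0,t)²` and
`|∫∫_{(0,t)²} ρ(s-σ) ⟨Φ(s), D(σ)⟩ dσ ds| ≤ R ∫_{(0,t)} ‖D(σ)‖_{L²} dσ` (`∫ ρ(s - σ) ds ≤ 1`). [folklore] -/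
theorem abs_integral_normed_mul_integral_inner_le (φ : ContDiffBump (0 : ℝ)) {t : ℝ}
    {D Φ : ℝ → X → V} (hD : StronglyMeasurable (uncurry D)) (hΦ : StronglyMeasurable (uncurry Φ))
    (hD1 : ∫⁻ s in Ioo 0 t, eLpNorm (D s) 2 μ < ∞) {R : ℝ≥0} (hΦR : ∀ s, eLpNorm (Φ s) 2 μ ≤ R) :
    Integrable (fun p : ℝ × ℝ => φ.normed volume (p.2 - p.1) * ∫ x, ⟪Φ p.2 x, D p.1 x⟫ ∂μ)
        ((volume.restrict (Ioo 0 t)).prod (volume.restrict (Ioo 0 t))) ∧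
      |∫ p, φ.normed volume (p.2 - p.1) * ∫ x, ⟪Φ p.2 x, D p.1 x⟫ ∂μ
          ∂((volume.restrict (Ioo 0 t)).prod (volume.restrict (Ioo 0 t)))| ≤
        R * (∫⁻ s in Ioo 0 t, eLpNorm (D s) 2 μ).toReal := by
  set νt : Measure ℝ := volume.restrict (Ioo 0 t) with hνt
  haveI : IsFiniteMeasure νt := by rw [hνt]; infer_instance
  set ρ : ℝ → ℝ := φ.normed volume with hρ
  obtain ⟨Cρ, hCρ0, hCρ⟩ := FunctionSpaces.exists_normed_le φ
  set N : ℝ → ℝ≥0∞ := fun s => eLpNorm (D s) 2 μ with hN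
  have hNm : Measurable N := FunctionSpaces.measurable_eLpNorm_slice hD 2
  have hNfin : ∀ᵐ s ∂νt, N s < ⊤ := ae_lt_top hNm hD1.ne
  have hNint : Integrable (fun s => (N s).toReal) νt :=
    integrable_toReal_of_lintegral_ne_top hNm.aemeasurable hD1.ne
  -- measurability of the weighted pairing
  have hIm := stronglyMeasurable_integral_inner_slice (μ := μ) hD hΦ
  have hρc : Continuous fun p : ℝ × ℝ => ρ (p.2 - p.1) :=
    φ.continuous_normed.comp (continuous_snd.sub continuous_fst)
  have hm : AEStronglyMeasurable (fun p : ℝ × ℝ => ρ (p.2 - p.1) * ∫ x, ⟪Φ p.2 x, D p.1 x⟫ ∂μ)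
      (νt.prod νt) := hρc.aestronglyMeasurable.mul hIm.aestronglyMeasurable
  -- the dominating function `b(σ,s) = ρ(s-σ) R ‖D σ‖₂`
  set b : ℝ × ℝ → ℝ := fun p => ρ (p.2 - p.1) * (R * (N p.1).toReal) with hb
  have hbm : AEStronglyMeasurable b (νt.prod νt) :=
    hρc.aestronglyMeasurable.mul
      (measurable_const.mul (hNm.ennreal_toReal.comp measurable_fst)).aestronglyMeasurable
  have hmaj : Integrable (fun p : ℝ × ℝ => (R * (N p.1).toReal) * Cρ) (νt.prod νt) :=
    (hNint.const_mul (R : ℝ)).mul_prod (integrable_const Cρ)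
  have hbint : Integrable b (νt.prod νt) := by
    refine hmaj.mono' hbm (ae_of_all _ fun p => ?_)
    rw [hb, Real.norm_eq_abs, abs_mul, abs_of_nonneg (φ.nonneg_normed _),
      abs_of_nonneg (by positivity), mul_comm]
    exact mul_le_mul_of_nonneg_left (hCρ _) (by positivity)
  -- integrability of the weighted pairing
  have hae : ∀ᵐ p ∂(νt.prod νt), ‖ρ (p.2 - p.1) * ∫ x, ⟪Φ p.2 x, D p.1 x⟫ ∂μ‖ ≤ b p := by
    filter_upwards [(Measure.quasiMeasurePreserving_fst (μ := νt) (ν := νt)).ae hNfin] with p hp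
    rw [norm_mul, Real.norm_eq_abs, abs_of_nonneg (φ.nonneg_normed _), hb]
    exact mul_le_mul_of_nonneg_left (norm_integral_inner_le_of_eLpNorm_le
      (hΦ.of_uncurry_left (x := p.2)).aestronglyMeasurable
      (hD.of_uncurry_left (x := p.1)).aestronglyMeasurable (hΦR p.2) hp) (φ.nonneg_normed _)
  have hint : Integrable (fun p : ℝ × ℝ => ρ (p.2 - p.1) * ∫ x, ⟪Φ p.2 x, D p.1 x⟫ ∂μ)
      (νt.prod νt) := hbint.mono' hm hae
  refine ⟨hint, ?_⟩
  -- the bound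
  rw [← Real.norm_eq_abs]
  refine (norm_integral_le_of_norm_le hbint hae).trans ?_
  rw [integral_prod _ hbint]
  have hinner : ∀ σ, ∫ s, b (σ, s) ∂νt = (R * (N σ).toReal) * ∫ s, ρ (s - σ) ∂νt := fun σ => by
    simp only [hb]
    rw [← integral_const_mul]
    refine integral_congr_ae (ae_of_all _ fun s => ?_)
    ring
  have hker : ∀ σ, ∫ s, ρ (s - σ) ∂νt ≤ 1 := fun σ => by
    have hi : Integrable (fun s => ρ (s - σ)) volume := φ.integrable_normed.comp_sub_right σ
    calc ∫ s, ρ (s - σ) ∂νt ≤ ∫ s, ρ (s - σ) :=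
          setIntegral_le_integral hi (ae_of_all _ fun s => φ.nonneg_normed _)
      _ = 1 := by rw [integral_sub_right_eq_self ρ σ, φ.integral_normed]
  have hker0 : ∀ σ, 0 ≤ ∫ s, ρ (s - σ) ∂νt := fun σ => integral_nonneg fun s => φ.nonneg_normed _
  calc ∫ σ, ∫ s, b (σ, s) ∂νt ∂νt ≤ ∫ σ, R * (N σ).toReal ∂νt := by
        refine integral_mono hbint.integral_prod_left (hNint.const_mul _) fun σ => ?_
        dsimp only
        rw [hinner σ]
        calc R * (N σ).toReal * ∫ s, ρ (s - σ) ∂νt ≤ R * (N σ).toReal * 1 :=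
              mul_le_mul_of_nonneg_left (hker σ) (by positivity)
          _ = R * (N σ).toReal := mul_one _
    _ = R * (∫⁻ s, N s ∂νt).toReal := by
        rw [integral_const_mul, integral_toReal hNm.aemeasurable hNfin]

omit [NormedAddCommGroup E] [InnerProductSpace ℝ E] [FiniteDimensional ℝ E] [MeasurableSpace E]
  [BorelSpace E] [CompleteSpace E] in
/-- **The mollified `L¹ₜL²ₓ – L^∞ₜL²ₓ` pairing converges.** Let `A, Φ : ℝ × X → V` be jointly
measurable, `∫_{(0,t)} ‖A(s)‖_{L²} ds < ∞` and `‖Φ(s)‖_{L²} ≤ R` for all `s`, and let `ρₙ` be even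
normalised bump kernels with `rOut → 0`. Then
`∫∫_{(0,t)²} ρₙ(s - σ) ⟨Φ(s), A(σ)⟩ dσ ds → ∫_{(0,t)} ⟨Φ(s), A(s)⟩ ds`
(the variant of the accepted `L²–L²` statement `tendsto_integral_normed_mul_integral_inner`
needed when one factor is only `L¹` in time, e.g. `(∇v + ∇vᵀ) v` under condition (8) of
Brenier–De Lellis–Székelyhidi). Proof: truncate `A` at the levels `‖A(s)‖_{L²} ≤ M`, apply the
`L²–L²` statement, and remove the truncation uniformly in `n`
(`abs_integral_normed_mul_integral_inner_le`). [folklore] -/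
theorem tendsto_integral_normed_mul_integral_inner_of_eLpNorm_le {φ : ℕ → ContDiffBump (0 : ℝ)}
    (hφ : Tendsto (fun n => (φ n).rOut) atTop (𝓝 0)) {t : ℝ} {A Φ : ℝ → X → V}
    (hA : StronglyMeasurable (uncurry A)) (hΦ : StronglyMeasurable (uncurry Φ))
    (hA1 : ∫⁻ s in Ioo 0 t, eLpNorm (A s) 2 μ < ∞) {R : ℝ≥0} (hΦR : ∀ s, eLpNorm (Φ s) 2 μ ≤ R) :
    Tendsto (fun n => ∫ p, (φ n).normed volume (p.2 - p.1) * ∫ x, ⟪Φ p.2 x, A p.1 x⟫ ∂μ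
        ∂((volume.restrict (Ioo 0 t)).prod (volume.restrict (Ioo 0 t))))
      atTop (𝓝 (∫ z, ⟪Φ z.1 z.2, A z.1 z.2⟫ ∂((volume.restrict (Ioo 0 t)).prod μ))) := by
  set νt : Measure ℝ := volume.restrict (Ioo 0 t) with hνt
  haveI : IsFiniteMeasure νt := by rw [hνt]; infer_instance
  set N : ℝ → ℝ≥0∞ := fun s => eLpNorm (A s) 2 μ with hN
  have hNm : Measurable N := FunctionSpaces.measurable_eLpNorm_slice hA 2
  have hNfin : ∀ᵐ s ∂νt, N s < ⊤ := ae_lt_top hNm hA1.ne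
  -- ### truncations
  set TM : ℕ → Set ℝ := fun M => {s | N s ≤ M} with hTM
  have hTMm : ∀ M, MeasurableSet (TM M) := fun M => measurableSet_le hNm measurable_const
  set AM : ℕ → ℝ → X → V := fun M s x => (TM M).indicator (fun s => A s x) s with hAM
  set DM : ℕ → ℝ → X → V := fun M s x => (TM M)ᶜ.indicator (fun s => A s x) s with hDM
  have hAMu : ∀ M, uncurry (AM M) = {z : ℝ × X | z.1 ∈ TM M}.indicator (uncurry A) := by
    intro M; ext z; simp only [hAM, uncurry, indicator_apply, mem_setOf_eq]
  have hDMu : ∀ M, uncurry (DM M) = {z : ℝ × X | z.1 ∈ (TM M)ᶜ}.indicator (uncurry A) := by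
    intro M; ext z; simp only [hDM, uncurry, indicator_apply, mem_setOf_eq]
  have hAMm : ∀ M, StronglyMeasurable (uncurry (AM M)) := fun M => by
    rw [hAMu]; exact hA.indicator ((hTMm M).preimage measurable_fst)
  have hDMm : ∀ M, StronglyMeasurable (uncurry (DM M)) := fun M => by
    rw [hDMu]; exact hA.indicator ((hTMm M).compl.preimage measurable_fst)
  have hAM_slice : ∀ M s, AM M s = (TM M).indicator A s := by
    intro M s; ext x; by_cases hs : s ∈ TM M <;> simp [hAM, hs]
  have hDM_slice : ∀ M s, DM M s = (TM M)ᶜ.indicator A s := by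
    intro M s; ext x; by_cases hs : s ∈ (TM M)ᶜ <;> simp [hDM, hs]
  have hsplit : ∀ M s x, A s x = AM M s x + DM M s x := by
    intro M s x
    simp only [hAM, hDM]
    exact (Set.indicator_self_add_compl_apply (TM M) (fun s => A s x) s).symm
  have hNAM : ∀ M s, eLpNorm (AM M s) 2 μ ≤ M := by
    intro M s
    rw [hAM_slice]
    by_cases hs : s ∈ TM M
    · rw [indicator_of_mem hs]; exact hs
    · rw [indicator_of_notMem hs]; simp
  have hNDM : ∀ M s, eLpNorm (DM M s) 2 μ = (TM M)ᶜ.indicator N s := by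
    intro M s
    rw [hDM_slice]
    by_cases hs : s ∈ (TM M)ᶜ
    · rw [indicator_of_mem hs, indicator_of_mem hs]
    · rw [indicator_of_notMem hs, indicator_of_notMem hs]; simp
  have hDM1 : ∀ M, ∫⁻ s in Ioo 0 t, eLpNorm (DM M s) 2 μ ≤ ∫⁻ s in Ioo 0 t, N s := fun M =>
    lintegral_mono fun s => by rw [hNDM]; exact indicator_le_self _ _ _
  have hAM1 : ∀ M, ∫⁻ s in Ioo 0 t, eLpNorm (AM M s) 2 μ < ∞ := fun M => by
    refine (lintegral_mono fun s => hNAM M s).trans_lt ?_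
    rw [lintegral_const]
    exact ENNReal.mul_lt_top ENNReal.coe_lt_top (measure_lt_top νt _)
  -- ### `L²((0,t) × X)` bounds of `A_M` and `Φ`
  have hsq : ∀ {B : ℝ → X → V} (hB : StronglyMeasurable (uncurry B)) {K : ℝ≥0},
      (∀ s, eLpNorm (B s) 2 μ ≤ K) → eLpNorm (uncurry B) 2 (νt.prod μ) < ∞ := by
    intro B hB K hK
    have h := FunctionSpaces.lintegral_eLpNorm_slice_sq (ν := νt) (μ := μ) hB
    have hle : ∫⁻ σ, eLpNorm (B σ) 2 μ ^ (2 : ℝ) ∂νt ≤ (K : ℝ≥0∞) ^ (2 : ℝ) * νt univ := by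
      calc ∫⁻ σ, eLpNorm (B σ) 2 μ ^ (2 : ℝ) ∂νt ≤ ∫⁻ σ, (K : ℝ≥0∞) ^ (2 : ℝ) ∂νt :=
            lintegral_mono fun σ => ENNReal.rpow_le_rpow (hK σ) zero_le_two
        _ = (K : ℝ≥0∞) ^ (2 : ℝ) * νt univ := lintegral_const _
    have hfin : eLpNorm (uncurry B) 2 (νt.prod μ) ^ (2 : ℝ) < ⊤ := by
      rw [← h]
      exact hle.trans_lt (ENNReal.mul_lt_top (ENNReal.rpow_lt_top_of_nonneg zero_le_two
        ENNReal.coe_ne_top) (measure_lt_top _ _))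
    by_contra htop
    rw [not_lt, top_le_iff] at htop
    rw [htop, ENNReal.top_rpow_of_pos zero_lt_two] at hfin
    exact lt_irrefl _ hfin
  have hAM2 : ∀ M, eLpNorm (uncurry (AM M)) 2 (νt.prod μ) < ∞ := fun M =>
    hsq (hAMm M) (K := (M : ℝ≥0)) (fun s => by exact_mod_cast hNAM M s)
  have hΦ2 : eLpNorm (uncurry Φ) 2 (νt.prod μ) < ∞ := hsq hΦ hΦR
  -- ### the truncated limits
  set xM : ℕ → ℕ → ℝ := fun M n => ∫ p, (φ n).normed volume (p.2 - p.1) *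
    ∫ x, ⟪Φ p.2 x, AM M p.1 x⟫ ∂μ ∂(νt.prod νt) with hxM
  set yM : ℕ → ℝ := fun M => ∫ z, ⟪Φ z.1 z.2, AM M z.1 z.2⟫ ∂(νt.prod μ) with hyM
  have h1 : ∀ M, Tendsto (xM M) atTop (𝓝 (yM M)) := fun M =>
    FunctionSpaces.tendsto_integral_normed_mul_integral_inner hφ (hAMm M) hΦ (hAM2 M) hΦ2
  -- ### the truncation errors
  set e : ℕ → ℝ := fun M => R * (∫⁻ s in Ioo 0 t, eLpNorm (DM M s) 2 μ).toReal with he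
  have hDMfin : ∀ M, ∫⁻ s in Ioo 0 t, eLpNorm (DM M s) 2 μ < ∞ := fun M =>
    (hDM1 M).trans_lt hA1
  have hx : ∀ M n, |(∫ p, (φ n).normed volume (p.2 - p.1) * ∫ x, ⟪Φ p.2 x, A p.1 x⟫ ∂μ
      ∂(νt.prod νt)) - xM M n| ≤ e M := by
    intro M n
    obtain ⟨iA, -⟩ := abs_integral_normed_mul_integral_inner_le (μ := μ) (φ n) hA hΦ hA1 hΦR
    obtain ⟨iAM, -⟩ := abs_integral_normed_mul_integral_inner_le (μ := μ) (φ n) (hAMm M) hΦ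
      (hAM1 M) hΦR
    obtain ⟨-, bD⟩ := abs_integral_normed_mul_integral_inner_le (μ := μ) (φ n) (hDMm M) hΦ
      (hDMfin M) hΦR
    rw [hxM]
    dsimp only
    rw [← integral_sub iA iAM]
    refine le_trans (le_of_eq ?_) bD
    congr 1
    refine integral_congr_ae ?_
    -- slice-wise: `⟨Φ(s), A(σ)⟩ - ⟨Φ(s), A_M(σ)⟩ = ⟨Φ(s), D_M(σ)⟩` where `‖A(σ)‖₂ < ∞`
    filter_upwards [(Measure.quasiMeasurePreserving_fst (μ := νt) (ν := νt)).ae hNfin] with p hp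
    have hΦp : MemLp (Φ p.2) 2 μ := ⟨(hΦ.of_uncurry_left (x := p.2)).aestronglyMeasurable,
      (hΦR p.2).trans_lt ENNReal.coe_lt_top⟩
    have hAp : MemLp (A p.1) 2 μ := ⟨(hA.of_uncurry_left (x := p.1)).aestronglyMeasurable, hp⟩
    have hAMp : MemLp (AM M p.1) 2 μ := ⟨((hAMm M).of_uncurry_left (x := p.1)).aestronglyMeasurable,
      (hNAM M p.1).trans_lt ENNReal.coe_lt_top⟩
    rw [← mul_sub, ← integral_sub (integrable_inner_of_memLp_two hΦp hAp)
      (integrable_inner_of_memLp_two hΦp hAMp)]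
    congr 1
    refine integral_congr_ae (ae_of_all _ fun x => ?_)
    dsimp only
    rw [← inner_sub_right, hsplit M p.1 x, add_sub_cancel_left]
  have hy : ∀ M, |(∫ z, ⟪Φ z.1 z.2, A z.1 z.2⟫ ∂(νt.prod μ)) - yM M| ≤ e M := by
    intro M
    obtain ⟨iA, -⟩ := integrable_inner_slab_of_eLpNorm_le (μ := μ) hA hΦ hA1 hΦR
    obtain ⟨iAM, -⟩ := integrable_inner_slab_of_eLpNorm_le (μ := μ) (hAMm M) hΦ (hAM1 M) hΦR
    obtain ⟨-, bD⟩ := integrable_inner_slab_of_eLpNorm_le (μ := μ) (hDMm M) hΦ (hDMfin M) hΦR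
    rw [hyM]
    dsimp only
    rw [← integral_sub iA iAM]
    refine le_trans (le_of_eq ?_) bD
    congr 1
    refine integral_congr_ae (ae_of_all _ fun z => ?_)
    dsimp only
    rw [← inner_sub_right, hsplit M z.1 z.2, add_sub_cancel_left]
  -- ### the errors tend to zero (dominated convergence in `s`)
  have he0 : Tendsto e atTop (𝓝 0) := by
    have hlin : Tendsto (fun M => ∫⁻ s in Ioo 0 t, eLpNorm (DM M s) 2 μ) atTop (𝓝 0) := by
      have h := tendsto_lintegral_of_dominated_convergence (μ := νt) N (F := fun M s =>
        eLpNorm (DM M s) 2 μ) (f := fun _ => 0)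
        (fun M => (FunctionSpaces.measurable_eLpNorm_slice (hDMm M) 2)) (fun M => ae_of_all _
          fun s => by dsimp only; rw [hNDM]; exact indicator_le_self _ _ _) hA1.ne ?_
      · simpa using h
      · filter_upwards [hNfin] with s hs
        obtain ⟨M₀, hM₀⟩ := exists_nat_ge (N s).toReal
        refine tendsto_atTop_of_eventually_const (i₀ := M₀) fun M hM => ?_
        rw [hNDM, indicator_of_notMem]
        simp only [mem_compl_iff, not_not, hTM, mem_setOf_eq]
        calc N s = ENNReal.ofReal (N s).toReal := (ENNReal.ofReal_toReal hs.ne).symm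
          _ ≤ ENNReal.ofReal M := ENNReal.ofReal_le_ofReal (hM₀.trans (by exact_mod_cast hM))
          _ = M := by simp
    have h2 : Tendsto (fun M => (∫⁻ s in Ioo 0 t, eLpNorm (DM M s) 2 μ).toReal) atTop (𝓝 0) := by
      rw [← ENNReal.toReal_zero]
      exact (ENNReal.tendsto_toReal ENNReal.zero_ne_top).comp hlin
    simpa [he] using h2.const_mul (R : ℝ)
  exact tendsto_of_approx_of_tendsto h1 hx hy he0

end TimeMollification

end Literature.Analysis.FluidPDE
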